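import Summits.Ventures.PercRepro.ExcessOneSelfDual
import Summits.Ventures.PercRepro.ThetaTwoPairs

/-!
# Conjecture V reduces to «every member of a residue instance is a difference or a co-difference»

Theorem Z (`forall_mem_diffs_or_forall_compl_mem_diffs`, ExcessOneSelfDual.lean) is Conjecture V*
at the near-member `u = ∅`. Here it is turned into a reduction of the cell's candidate proposition
`ConjV` (ThetaTwoPairs.lean): if every instance of `ConjV` — an MS-excess-1 family `F` disjoint
from its complement family, a near-member `u` with neither `F ∪ {u}` nor `F ∪ {uᶜ}` tight — has
`∅, univ ∉ F` and every member a difference or a co-difference, then `ConjV` holds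
(`conjV_of_forall_good`). The two auxiliary lemmas turn «`F ⊆ F \\ F`» resp. «`compls F ⊆ F \\ F`»
into the block form `F \\ F = insert ∅ F` resp. the mirror form `F \\ F = insert ∅ (compls F)` by
cardinality (proofs/MINE1-theoremS.md, Addendum 9 §7).
-/

namespace PercRepro.MSTight

open Finset
open scoped FinsetFamily

variable {α : Type*} [DecidableEq α] [Fintype α]

omit [Fintype α] in
/-- An excess-1 family without `∅` all of whose members are differences has `F \\ F = insert ∅ F`. -/
theorem diffs_eq_insert_empty_of_forall_mem {F : Finset (Finset α)}
    (hex : (F \\ F).card = F.card + 1) (h0 : (∅ : Finset α) ∉ F) (h : ∀ t ∈ F, t ∈ F \\ F) :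
    F \\ F = insert ∅ F := by
  obtain ⟨t₀, ht₀⟩ : F.Nonempty := by
    by_contra hemp
    rw [not_nonempty_iff_eq_empty] at hemp
    subst hemp
    simp at hex
  have hD0 : (∅ : Finset α) ∈ F \\ F := mem_diffs.2 ⟨t₀, ht₀, t₀, ht₀, Finset.sdiff_self t₀⟩
  have hsub : insert ∅ F ⊆ F \\ F := by
    intro x hx
    rcases mem_insert.1 hx with rfl | hx
    · exact hD0
    · exact h x hx
  symm
  apply eq_of_subset_of_card_le hsub
  rw [card_insert_of_notMem h0]
  omega

/-- An excess-1 family without `univ` all of whose complements of members are differences has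
`F \\ F = insert ∅ (compls F)`. -/
theorem diffs_eq_insert_empty_compls_of_forall_compl_mem {F : Finset (Finset α)}
    (hex : (F \\ F).card = F.card + 1) (hU : (Finset.univ : Finset α) ∉ F)
    (h : ∀ t ∈ F, Finset.univ \ t ∈ F \\ F) : F \\ F = insert ∅ (compls F) := by
  obtain ⟨t₀, ht₀⟩ : F.Nonempty := by
    by_contra hemp
    rw [not_nonempty_iff_eq_empty] at hemp
    subst hemp
    simp at hex
  have hD0 : (∅ : Finset α) ∈ F \\ F := mem_diffs.2 ⟨t₀, ht₀, t₀, ht₀, Finset.sdiff_self t₀⟩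
  have h0c : (∅ : Finset α) ∉ compls F := by
    intro hx
    have := mem_compls.1 hx
    rw [Finset.sdiff_empty] at this
    exact hU this
  have hsub : insert ∅ (compls F) ⊆ F \\ F := by
    intro x hx
    rcases mem_insert.1 hx with rfl | hx
    · exact hD0
    · have hx' := h _ (mem_compls.1 hx)
      rwa [Finset.sdiff_sdiff_eq_self (subset_univ x)] at hx'
  symm
  apply eq_of_subset_of_card_le hsub
  rw [card_insert_of_notMem h0c, card_compls]
  omega

/-- **The reduction.** If every instance of Conjecture V has `∅, univ ∉ F` and every member a
difference or a co-difference, then Conjecture V holds. -/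
theorem conjV_of_forall_good
    (hT2 : ∀ (F : Finset (Finset α)) (σ : Finset α → Bool) (u : Finset α),
      Disjoint F (compls F) → (F \\ F).card = F.card + 1 → u ∉ F → Finset.univ \ u ∉ F →
      (∀ t ∈ F, Cells (F \\ F) t (if σ t = true then u else Finset.univ \ u)) →
      ¬ Tight (insert u F) → ¬ Tight (insert (Finset.univ \ u) F) →
      ((∅ : Finset α) ∉ F ∧ (Finset.univ : Finset α) ∉ F ∧
        ∀ t ∈ F, t ∈ F \\ F ∨ Finset.univ \ t ∈ F \\ F)) :
    ConjV α := by
  intro F σ u hval hex hu huc hcells hnt hntc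
  obtain ⟨h0, hU, hgood⟩ := hT2 F σ u hval hex hu huc hcells hnt hntc
  rcases forall_mem_diffs_or_forall_compl_mem_diffs hval hex hgood with h | h
  · exact Or.inl (diffs_eq_insert_empty_of_forall_mem hex h0 h)
  · exact Or.inr (diffs_eq_insert_empty_compls_of_forall_compl_mem hex hU h)

end PercRepro.MSTight
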